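import Literature.Analysis.Asymptotics.TwoWallCoefficientRecurrences
import HarnessLib

/-!
# The limit constant of a dominant-root linear recurrence is EXPLICIT: `L = (b₂ + p b₁ + κ b₀)/(s² + ps + κ)`

Topic `Literature/Analysis/Asymptotics` (continues `ComplexLinearRecurrenceDominantRoot.lean` — `exists_tendsto_norm_sub_le_of_rec_three_complex`:
for `b(n+3) = A b(n+2) + B b(n+1) + C b(n)` with characteristic polynomial `(τ − s)(τ² + pτ + κ)` whose cofactor roots have modulus `≤ R < |s|`,
`b(n) = L sⁿ + O((n+1)Rⁿ)` for SOME `L = lim b(n)/sⁿ` — and `TwoWallCoefficientRecurrences.lean` — the parity form `exists_tendsto_parity_of_rec_six`).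
The point of this file: the constant `L` is not just a limit but an EXPLICIT rational expression in three consecutive values, because the cofactor
combination `g(n) = b(n+2) + p b(n+1) + κ b(n)` is EXACTLY geometric, `g(n) = g(0)sⁿ`.  Consequently `L` depends continuously (indeed rationally) on
the data — which is what a perturbation in a parameter (complex fugacity `ye^{it}`, `|t| < t₀`) needs for the amplitude ratio `L(t)/L(0) = 1 + O(t)`.

* `rec_three_cofactor_geometric` — `b(n+2) + p b(n+1) + κ b(n) = (b₂ + p b₁ + κ b₀)·sⁿ` (any commutative ring).
* ★ `limit_eq_of_rec_three` — if `b(n)/sⁿ → L`, `s ≠ 0`, `s² + ps + κ ≠ 0` then `L = (b₂ + p b₁ + κ b₀)/(s² + ps + κ)`.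
* ★★ `norm_sub_limitFormula_mul_pow_le_of_rec_three` — the bound of `exists_tendsto_norm_sub_le_of_rec_three_complex` with THIS explicit `L`.
* ★★ `norm_parity_sub_limitFormula_mul_pow_le` — the parity form (order-6 two-wall recurrence at fugacities `w, v`; `p = s − w − v`, `κ = wv/s`):
  `‖e(2M+c) − L_c s^M‖ ≤ (…)(M+1)R^M`, `L_c = (e(4+c) + (s − w − v)e(2+c) + (wv/s)e(c))/(s² + (s − w − v)s + wv/s)`.

## Sources
R. P. Stanley, *Enumerative Combinatorics* I (2nd ed.), §4.1 Theorem 4.1.1 ((i) ⟺ (iii): rational generating functions ⟺ linear recurrences, and the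
partial-fraction form of the coefficients); lane statements, nothing quoted AS PRINTED.
-/

noncomputable section

open Filter
open scoped Topology

namespace Literature.Analysis.Asymptotics

/-- **The cofactor combination is exactly geometric**: if `b(n+3) = A b(n+2) + B b(n+1) + C b(n)` with `A = s − p`, `B = ps − κ`, `C = κs`
(i.e. characteristic polynomial `(τ − s)(τ² + pτ + κ)`), then `b(n+2) + p b(n+1) + κ b(n) = (b₂ + p b₁ + κ b₀)·sⁿ`.
[cite: Stanley2012EC1, §4.1 Theorem 4.1.1 (lane statement)] -/
theorem rec_three_cofactor_geometric {K : Type*} [CommRing K] {A B C s p κ : K} (hA : A = s - p) (hB : B = p * s - κ) (hC : C = κ * s)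
    (b : ℕ → K) (hb : ∀ n, b (n + 3) = A * b (n + 2) + B * b (n + 1) + C * b n) (n : ℕ) :
    b (n + 2) + p * b (n + 1) + κ * b n = (b 2 + p * b 1 + κ * b 0) * s ^ n := by
  induction n with
  | zero => simp
  | succ n ih =>
    have h := hb n
    show b (n + 3) + p * b (n + 2) + κ * b (n + 1) = (b 2 + p * b 1 + κ * b 0) * s ^ (n + 1)
    calc b (n + 3) + p * b (n + 2) + κ * b (n + 1) = s * (b (n + 2) + p * b (n + 1) + κ * b n) := by rw [h, hA, hB, hC]; ring
      _ = (b 2 + p * b 1 + κ * b 0) * s ^ (n + 1) := by rw [ih]; ring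

/-- ★ **The limit constant is explicit**: if moreover `b(n)/sⁿ → L` (`s ≠ 0`, `s² + ps + κ ≠ 0` — `s` is not a cofactor root), then
`L = (b₂ + p b₁ + κ b₀)/(s² + ps + κ)`. [cite: Stanley2012EC1, §4.1 Theorem 4.1.1 (iii) (lane statement)] -/
theorem limit_eq_of_rec_three {A B C s p κ : ℂ} (hA : A = s - p) (hB : B = p * s - κ) (hC : C = κ * s) (hs : s ≠ 0)
    (hq : s ^ 2 + p * s + κ ≠ 0) (b : ℕ → ℂ) (hb : ∀ n, b (n + 3) = A * b (n + 2) + B * b (n + 1) + C * b n) {L : ℂ}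
    (hL : Tendsto (fun n => b n / s ^ n) atTop (𝓝 L)) :
    L = (b 2 + p * b 1 + κ * b 0) / (s ^ 2 + p * s + κ) := by
  have h2 : Tendsto (fun n => b (n + 2) / s ^ (n + 2)) atTop (𝓝 L) := hL.comp (tendsto_add_atTop_nat 2)
  have h1 : Tendsto (fun n => b (n + 1) / s ^ (n + 1)) atTop (𝓝 L) := hL.comp (tendsto_add_atTop_nat 1)
  have hsum : Tendsto (fun n => s ^ 2 * (b (n + 2) / s ^ (n + 2)) + p * s * (b (n + 1) / s ^ (n + 1)) + κ * (b n / s ^ n)) atTop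
      (𝓝 (s ^ 2 * L + p * s * L + κ * L)) :=
    ((h2.const_mul _).add (h1.const_mul _)).add (hL.const_mul _)
  have hconst : ∀ n, s ^ 2 * (b (n + 2) / s ^ (n + 2)) + p * s * (b (n + 1) / s ^ (n + 1)) + κ * (b n / s ^ n)
      = b 2 + p * b 1 + κ * b 0 := by
    intro n
    have hg := rec_three_cofactor_geometric hA hB hC b hb n
    have hsn : s ^ n ≠ 0 := pow_ne_zero _ hs
    have e : s ^ 2 * (b (n + 2) / s ^ (n + 2)) + p * s * (b (n + 1) / s ^ (n + 1)) + κ * (b n / s ^ n)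
        = (b (n + 2) + p * b (n + 1) + κ * b n) / s ^ n := by
      field_simp
      ring
    rw [e, hg, mul_div_assoc, div_self hsn, mul_one]
  have key : b 2 + p * b 1 + κ * b 0 = s ^ 2 * L + p * s * L + κ * L :=
    tendsto_nhds_unique (tendsto_const_nhds.congr fun n => (hconst n).symm) hsum
  rw [eq_div_iff hq]
  linear_combination (-1 : ℂ) * key

/-- ★★ **Dominant-root two-term bound with the EXPLICIT constant**: under the hypotheses of `exists_tendsto_norm_sub_le_of_rec_three_complex`
(cofactor roots of modulus `≤ R`, `0 < R < |s|`), for every `n`,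
`‖b(n) − ((b₂ + p b₁ + κ b₀)/(s² + ps + κ))·sⁿ‖ ≤ (‖b₁ − s b₀‖ + ‖b₂ − s b₁‖/R)(n+1)Rⁿ·|s|/(|s| − R)²`.
[cite: Stanley2012EC1, §4.1 Theorem 4.1.1 (iii) (lane statement)] -/
theorem norm_sub_limitFormula_mul_pow_le_of_rec_three {A B C s p κ : ℂ} {R : ℝ} (hR0 : 0 < R) (hRs : R < ‖s‖)
    (hA : A = s - p) (hB : B = p * s - κ) (hC : C = κ * s)
    (hroot : ∀ σ : ℂ, σ ^ 2 + p * σ + κ = 0 → ‖σ‖ ≤ R)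
    (b : ℕ → ℂ) (hb : ∀ n, b (n + 3) = A * b (n + 2) + B * b (n + 1) + C * b n) (n : ℕ) :
    ‖b n - (b 2 + p * b 1 + κ * b 0) / (s ^ 2 + p * s + κ) * s ^ n‖ ≤
      (‖b 1 - s * b 0‖ + ‖b 2 - s * b 1‖ / R) * ((n : ℝ) + 1) * R ^ n * (‖s‖ / (‖s‖ - R) ^ 2) := by
  obtain ⟨L, hL, hbound⟩ := exists_tendsto_norm_sub_le_of_rec_three_complex hR0 hRs hA hB hC hroot b hb
  have hs : s ≠ 0 := by
    intro h; rw [h, norm_zero] at hRs; linarith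
  have hq : s ^ 2 + p * s + κ ≠ 0 := by
    intro h
    have := hroot s h
    linarith
  rw [← limit_eq_of_rec_three hA hB hC hs hq b hb hL]
  exact hbound n

/-- ★★ **Parity form for the order-6 two-wall recurrence** `e(N+6) = (w+v)e(N+4) − wv·e(N+2) + wv·e(N)` with `s(s−w)(s−v) = wv`, `s ≠ 0`, cofactor
roots (of `σ² + (s−w−v)σ + wv/s`) of modulus `≤ R`, `0 < R < |s|`: for each parity offset `c` and every `M`,
`‖e(2M+c) − L_c·s^M‖ ≤ (‖e(2+c) − s e(c)‖ + ‖e(4+c) − s e(2+c)‖/R)(M+1)R^M·|s|/(|s|−R)²` with the EXPLICIT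
`L_c = (e(4+c) + (s−w−v)e(2+c) + (wv/s)e(c))/(s² + (s−w−v)s + wv/s)` — a rational function of `(s, w, v, e(c), e(2+c), e(4+c))`, hence continuous
in any parameter the data depend continuously on. [cite: Stanley2012EC1, §4.1 Theorem 4.1.1 (iii) (lane statement)] -/
theorem norm_parity_sub_limitFormula_mul_pow_le {w v s : ℂ} {R : ℝ} {e : ℕ → ℂ}
    (he : ∀ N, e (N + 6) = (w + v) * e (N + 4) - w * v * e (N + 2) + w * v * e N)
    (hs : s ≠ 0) (hcubic : s * (s - w) * (s - v) = w * v) (hR0 : 0 < R) (hRs : R < ‖s‖)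
    (hroot : ∀ σ : ℂ, σ ^ 2 + (s - w - v) * σ + w * v / s = 0 → ‖σ‖ ≤ R) (c M : ℕ) :
    ‖e (2 * M + c) - (e (2 * 2 + c) + (s - w - v) * e (2 * 1 + c) + w * v / s * e (2 * 0 + c))
        / (s ^ 2 + (s - w - v) * s + w * v / s) * s ^ M‖ ≤
      (‖e (2 * 1 + c) - s * e (2 * 0 + c)‖ + ‖e (2 * 2 + c) - s * e (2 * 1 + c)‖ / R) * ((M : ℝ) + 1) * R ^ M
        * (‖s‖ / (‖s‖ - R) ^ 2) := by
  obtain ⟨hA, hB, hC⟩ := cubic_charpoly_data hs hcubic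
  exact norm_sub_limitFormula_mul_pow_le_of_rec_three hR0 hRs hA hB hC hroot (fun M => e (2 * M + c))
    (fun M => parity_rec_three he c M) M

end Literature.Analysis.Asymptotics

end
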